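import Mathlib
import HarnessLib.Audit
import Summits.PneNP.PneNP.Theorems.PstarGateCaseTRankSix
import Summits.PneNP.PneNP.Theorems.PstarGateAffine
import Summits.PneNP.PneNP.Theorems.PstarGateForest
import Summits.PneNP.PneNP.Theorems.PstarNorUnitEQ1Tools

/-!
# One GATED chord, CASE T with affine `q_mv` (the OR-reader family) is impossible at rank six (E2 node N3X, high rank; prover-1 g19)

FRONTIER range-avoidance ladder, rung F-N3 (`stmt-PneNP-19007`), cell `pnp-ideate` (`PstarGateNodesX.GateOrFamilyX`); restricted-model proof
complexity — nothing here bears on `P` versus `NP`.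

CASE T, `q_mv` affine (so `q_mv = ℓ + 1`, `PstarGateAffine.caseT_affine_const`, and `polarDir mv = 0`), `Q_{D e}` of rank `≥ 6` on `W`.  By
`PstarGateCaseTRankSix`: `κ₀ = 1`, every other chord satisfies `u_{e'} = u_e + 1` on the chamber `H₁ = {x_u = 0}` and contains every `u`-avoiding
edge `a` of `D e`, and `q_{(1,0)}|_{H₁} ∈ {σ₀ + 1, u_e + σ₀ + 1}`.  Minimality at such an edge `a` (defect form, all chords flipped,
`PstarGateForest.gate_forest_minimality`): pairing the value equation with `mv` gives `q_mv(x) + x_p ℓ(x) = 0`, i.e. `x ∈ H₁`, `x_p = 0`, so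
`u_e(x) = 1`, every other chord is OFF at `x`, all its privates are `1`, and the second coordinate reads `q_{(1,0)}(x) = [a ∈ T₂] + σ₀` — while
`[a ∈ T₂] = polarDir (1,0)(e_{a₂}, e_{a₃})` is `0` in the first case and `1` in the second (`polarDir_single_pair`, four chamber points):

* `caseT_six_false_affine` — **contradiction.**
-/

set_option linter.dupNamespace false -- `Summit.PneNP.PneNP.…`: summit = sub-problem name (D-0017 single-conjunct layout)

open Finset Module Literature.Computability.Complexity
open scoped symmDiff
open Summit.PneNP.PneNP.Theorems.PstarFibrePolys (bit)
open Summit.PneNP.PneNP.Theorems.PstarTyped (Typed)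
open Summit.PneNP.PneNP.Theorems.PstarSALevel (BoundaryExpanding SimpleOverlap)
open Summit.PneNP.PneNP.Theorems.PstarCubeIdeals (IsAffineFn)
open Summit.PneNP.PneNP.Theorems.PstarProductRank (qform polar)
open Summit.PneNP.PneNP.Theorems.PstarPathRank (polar_basis)
open Summit.PneNP.PneNP.Theorems.PstarQuadRank (rad)
open Summit.PneNP.PneNP.Theorems.PstarPathRankFibre (coordKer mem_coordKer avoid)
open Summit.PneNP.PneNP.Theorems.PstarReadSumset (V2)
open Summit.PneNP.PneNP.Theorems.PstarChordSystem (ChordSystem)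
open Summit.PneNP.PneNP.Theorems.PstarChordSystemMap (omega)
open Summit.PneNP.PneNP.Theorems.PstarChordBridgeTools (privs coef vars_mem_privs)
open Summit.PneNP.PneNP.Theorems.PstarChordBridge (BridgeData sys Solution Lift)
open Summit.PneNP.PneNP.Theorems.PstarChordBridgeForcing (gam sys_u_eq)
open Summit.PneNP.PneNP.Theorems.PstarChordBridgeBasis (qDir polarDir)
open Summit.PneNP.PneNP.Theorems.PstarChordBridgeCorner (qDir_add omega_F omega_add_left omega_smul andAdj_iff_mem)
open Summit.PneNP.PneNP.Theorems.PstarChordBridgeForest (defect_eq_one)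
open Summit.PneNP.PneNP.Theorems.PstarGateBridge (GateHyp const_of_others gate_reads)
open Summit.PneNP.PneNP.Theorems.PstarGateForest (gate_forest_minimality)
open Summit.PneNP.PneNP.Theorems.PstarGateCaseTLocal (u_add)
open Summit.PneNP.PneNP.Theorems.PstarGateFibreRank (avoid_nonempty)
open Summit.PneNP.PneNP.Theorems.PstarGateAffine (caseT_affine_const)
open Summit.PneNP.PneNP.Theorems.PstarNorUnitEQ1Tools (polarDir_single_pair)
open Summit.PneNP.PneNP.Theorems.PstarGateNodes (GateData)
open Summit.PneNP.PneNP.Theorems.PstarGateNodesX (GateDataX)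
open Summit.PneNP.PneNP.Theorems.PstarGateCaseTRankSix (caseT_six_coupled caseT_six_through caseT_six_q sigma_const)

namespace Summit.PneNP.PneNP.Theorems.PstarGateCaseTSixAffine

variable {n m : ℕ}

/-- `ω(·, m)` is additive over finite sums. -/
theorem omega_sum {ι : Type*} (s : Finset ι) (f : ι → V2) (mv : V2) : omega (∑ i ∈ s, f i) mv = ∑ i ∈ s, omega (f i) mv := by
  classical
  induction s using Finset.induction_on with
  | empty => simp [omega]
  | insert i s hi ih => rw [sum_insert hi, sum_insert hi, omega_add_left, ih]

/-- **N3X at rank six is contradictory.**  See the module docstring. -/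
theorem caseT_six_false_affine (I : LocalMap 4 n m) (hI : I.IsPure xorAndPred) (hT : Typed I) (hS : SimpleOverlap I) {r₀ : ℕ}
    (hB : BoundaryExpanding r₀ I) {B : BridgeData n m} {e g₀ : Fin m} {u : Fin n} {κ₀ : ZMod 2} (hD : GateDataX I r₀ B e g₀ u κ₀)
    {mv : V2} (hmvT : mv = (0, 1) ∨ mv = (1, 1))
    (hP : ∀ e' ∈ B.N, e' ≠ e → ∀ a, ((sys I B).ρ e' a = 0 ∨ (sys I B).ρ e' a = mv) ∧ ((sys I B).ρ' e' a = 0 ∨ (sys I B).ρ' e' a = mv))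
    (hread : ∀ e' ∈ B.N, e' ≠ e → ∀ a, (sys I B).ρ e' a ≠ 0 ∨ (sys I B).ρ' e' a ≠ 0) (hN : (B.N.erase e).Nonempty)
    (hq : IsAffineFn (qDir I B mv))
    (h6 : finrank (ZMod 2) (rad ((polar (B.D e) (fun j => I.vars j 2) (fun j => I.vars j 3)).restrict (coordKer ({u} : Finset (Fin n))))) + 6 ≤
      finrank (ZMod 2) (coordKer ({u} : Finset (Fin n)))) : False := by
  classical
  obtain ⟨hXc, hW, hr, hd₁, hd₂, hL, -, -, hG, hg₀, hgv, -, hup, hux, hG₁p, hcoef, hT3, hM0⟩ := id hD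
  have he : e ∈ B.N := hG.1
  have heD : e ∉ B.D e := fun h => (mem_sdiff.1 (hW.hD e he h)).2 he
  have hJr : B.J₀.card ≤ r₀ := (card_le_card (subset_union_left.trans subset_union_left)).trans hr
  obtain ⟨e₁, he₁⟩ := hN
  obtain ⟨hne₁, he₁N⟩ := mem_erase.1 he₁
  -- rank-six structure
  obtain ⟨hκ, -⟩ := caseT_six_through I hI hT hS hD hmvT hP hread h6 he₁N hne₁
  have hcpl : ∀ c ∈ B.N.erase e, ∀ x : Fin n → ZMod 2, x u = κ₀ + 1 → (sys I B).u c x = (sys I B).u e x + 1 := fun c hc =>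
    caseT_six_coupled I hI hT hS hD hmvT hP hread h6 (mem_of_mem_erase hc) (ne_of_mem_erase hc)
  have hthr : ∀ c ∈ B.N.erase e, ∀ j ∈ B.D e ∆ B.D c, I.vars j 2 = u ∨ I.vars j 3 = u := fun c hc =>
    (caseT_six_through I hI hT hS hD hmvT hP hread h6 (mem_of_mem_erase hc) (ne_of_mem_erase hc)).2
  have hq6 := caseT_six_q I hI hT hD hmvT hP hread h6
  set σ₀ := ∑ i ∈ B.N.erase e, (((sys I B).ρ i 0).2 + ((sys I B).ρ' i 0).2) with hσ₀
  -- an avoiding edge `a` of `D e`; it lies on every other fundamental set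
  obtain ⟨a, ha⟩ := avoid_nonempty I hI hS heD (hW.hDeven e he) u
  unfold PstarPathRankFibre.avoid at ha
  obtain ⟨haD, ha2, ha3⟩ := mem_filter.1 ha
  rw [mem_singleton] at ha2 ha3
  have haJ : a ∈ B.J₀ := (mem_sdiff.1 (hW.hD e he haD)).1
  have haDc : ∀ c ∈ B.N.erase e, a ∈ B.D c := by
    intro c hc
    by_contra hna
    rcases hthr c hc a (Finset.mem_symmDiff.2 (Or.inl ⟨haD, hna⟩)) with h | h
    · exact ha2 h
    · exact ha3 h
  -- `q_mv = ℓ + 1`, and `polarDir mv = 0`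
  have hA1 := caseT_affine_const I hI hT hS hB hW hJr hL hG hT3 hmvT hP hread hq hcoef he₁N hne₁
  have hpol0 : polarDir I B mv = 0 := by
    refine PstarForcing.polar_unique (qDir_add I B mv) (fun x w => ?_)
    rw [LinearMap.zero_apply, LinearMap.zero_apply, add_zero]
    exact hq x w
  have hτA : (if a ∈ B.T₁ then (1 : ZMod 2) else 0) * mv.2 + (if a ∈ B.T₂ then (1 : ZMod 2) else 0) * mv.1 = 0 := by
    have h := polarDir_single_pair I hI hS hd₁ hd₂ mv haJ
    rw [hpol0, LinearMap.zero_apply, LinearMap.zero_apply] at h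
    rw [mul_comm _ mv.2, mul_comm _ mv.1]
    exact h.symm
  -- (M0) at `a`, defect form
  obtain ⟨z, hz⟩ := hM0 a haJ
  have hpp' : I.vars e 2 ≠ I.vars e 3 := fun h => absurd (hI.2 e h) (by decide)
  have hp'priv : I.vars e 3 ∈ privs I B.N := vars_mem_privs I he (s := 3) (by decide)
  obtain ⟨hunG₁, hunG₂⟩ := hG.2.1 _ hp'priv (Ne.symm hpp')
  have hG₁'' : ∀ g ∈ B.G₁.erase g₀, I.vars g 2 ≠ I.vars e 2 ∧ I.vars g 2 ≠ I.vars e 3 ∧ I.vars g 3 ≠ I.vars e 2 ∧ I.vars g 3 ≠ I.vars e 3 :=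
    fun g hg => ⟨(hG₁p g hg).1, (hunG₁ g (mem_of_mem_erase hg)).1, (hG₁p g hg).2, (hunG₁ g (mem_of_mem_erase hg)).2⟩
  have hG₂'' : ∀ g ∈ B.G₂, I.vars g 2 ≠ I.vars e 2 ∧ I.vars g 2 ≠ I.vars e 3 ∧ I.vars g 3 ≠ I.vars e 2 ∧ I.vars g 3 ≠ I.vars e 3 :=
    fun g hg => ⟨(hG.2.2.1 g hg).1, (hunG₂ g hg).1, (hG.2.2.1 g hg).2, (hunG₂ g hg).2⟩
  obtain ⟨hchord, hval⟩ := gate_forest_minimality I hI hT hW he haD hg₀ hgv hup hG₁'' hG₂'' hz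
  have hδ := defect_eq_one I hI hW he haD hT3 hz
  set x : Fin n → ZMod 2 := fun v => bit (z v) with hxdef
  set st : Fin m → ZMod 2 × ZMod 2 := fun c => (bit (z (I.vars c 2)), bit (z (I.vars c 3))) with hst
  rw [hδ] at hval
  -- pairing with `mv`: only the gated chord contributes
  have hωval := congrArg (fun v => omega v mv) hval
  unfold ChordSystem.val at hωval
  rw [omega_add_left, omega_add_left, omega_sum, ← add_sum_erase B.N _ he] at hωval
  have hmv2 : mv.2 = 1 := by rcases hmvT with h | h <;> rw [h]
  have hωe : omega ((sys I B).contrib x st e) mv = bit (z (I.vars e 2)) * coef I B.C₁ B.G₁ (I.vars e 2) x := by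
    unfold ChordSystem.contrib
    rw [(gate_reads I hI hG x).1, (gate_reads I hI hG x).2, smul_zero, add_zero, omega_smul]
    show bit (z (I.vars e 2)) * omega (coef I B.C₁ B.G₁ (I.vars e 2) x, 0) mv = _
    unfold omega
    rw [hmv2]; ring
  have hωc : ∀ c ∈ B.N.erase e, omega ((sys I B).contrib x st c) mv = 0 := by
    intro c hc
    obtain ⟨hne', hcN⟩ := mem_erase.1 hc
    unfold ChordSystem.contrib
    rw [omega_add_left, omega_smul, omega_smul]
    have hω0 : ∀ y : V2, (y = 0 ∨ y = mv) → omega y mv = 0 := by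
      intro y hy
      rcases hy with hy | hy <;> rw [hy] <;> unfold omega
      · simp
      · rw [mul_comm mv.2 mv.1]; exact CharTwo.add_self_eq_zero _
    show (st c).1 * omega ((sys I B).ρ c x) mv + (st c).2 * omega ((sys I B).ρ' c x) mv = 0
    rw [hω0 _ (hP c hcN hne' x).1, hω0 _ (hP c hcN hne' x).2, mul_zero, mul_zero, add_zero]
  rw [sum_eq_zero hωc, add_zero, hωe] at hωval
  have hωτ : omega ((if a ∈ B.T₁ then (1 : ZMod 2) else 0), (if a ∈ B.T₂ then (1 : ZMod 2) else 0)) mv = 0 := by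
    unfold omega; simp only; rw [hτA]
  rw [hωτ, add_zero] at hωval
  -- so `q_mv(x) + x_p ℓ(x) = 0`: `x ∈ H₁` and `x_p = 0`
  have hmain : qDir I B mv x + bit (z (I.vars e 2)) * coef I B.C₁ B.G₁ (I.vars e 2) x = 0 := by
    rw [← omega_F]
    rw [omega_add_left]
    have e2 : ∀ f c t : ZMod 2, f + c = t → f + t + c = 0 := by decide
    exact e2 _ _ _ hωval
  have hxu : x u = 0 ∧ bit (z (I.vars e 2)) = 0 := by
    have h1 := hA1 x
    rw [hcoef] at h1 hmain
    rw [hκ] at h1 hmain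
    generalize qDir I B mv x = A at h1 hmain
    generalize x u = xu at h1 hmain
    generalize bit (z (I.vars e 2)) = xp at hmain
    revert h1 hmain; revert A xu xp; decide
  have hxH : x u = κ₀ + 1 := by rw [hxu.1, hκ]; decide
  have hue : (sys I B).u e x = 1 := by
    have h := hδ
    rw [hxu.2, zero_mul, add_zero] at h
    exact h
  -- every other chord is OFF at `x`, so its privates are both `1`
  have hones : ∀ c ∈ B.N.erase e, bit (z (I.vars c 2)) = 1 ∧ bit (z (I.vars c 3)) = 1 := by
    intro c hc
    obtain ⟨hne', hcN⟩ := mem_erase.1 hc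
    have h := hchord c hcN hne'
    rw [if_pos (haDc c hc), hδ, hcpl c hc x hxH, hue] at h
    have e2 : ∀ s t : ZMod 2, s * t = 1 + 1 + 1 → s = 1 ∧ t = 1 := by decide
    exact e2 _ _ h
  -- the second coordinate: `q_{(1,0)}(x) = [a ∈ T₂] + σ₀`
  have h2 := congrArg Prod.snd hval
  unfold ChordSystem.val at h2
  rw [Prod.snd_add, Prod.snd_add, Prod.snd_sum, ← add_sum_erase B.N _ he] at h2
  have h2e : ((sys I B).contrib x st e).2 = 0 := by
    unfold ChordSystem.contrib
    rw [(gate_reads I hI hG x).1, (gate_reads I hI hG x).2, smul_zero, add_zero, Prod.smul_snd, smul_eq_mul, mul_zero]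
  have h2c : ∀ c ∈ B.N.erase e, ((sys I B).contrib x st c).2 = ((sys I B).ρ c x).2 + ((sys I B).ρ' c x).2 := by
    intro c hc
    unfold ChordSystem.contrib
    rw [Prod.snd_add, Prod.smul_snd, Prod.smul_snd, smul_eq_mul, smul_eq_mul]
    show bit (z (I.vars c 2)) * _ + bit (z (I.vars c 3)) * _ = _
    rw [(hones c hc).1, (hones c hc).2, one_mul, one_mul]
  rw [h2e, zero_add, sum_congr rfl h2c, sigma_const I hW hG x] at h2
  have hq2 : qDir I B (1, 0) x = (if a ∈ B.T₂ then 1 else 0) + σ₀ := by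
    unfold PstarChordBridgeBasis.qDir
    simp only [zero_mul, one_mul, zero_add]
    have e3 : ∀ F s t τ : ZMod 2, F + s = t + τ → F + t = τ + s := by decide
    exact e3 _ _ _ _ h2
  -- `[a ∈ T₂]` from the polar form of `q_{(1,0)}` at the pair of `a`, computed on four chamber points
  have hT₂ : polarDir I B (1, 0) (Pi.single (I.vars a 2) 1) (Pi.single (I.vars a 3) 1) = if a ∈ B.T₂ then 1 else 0 := by
    have h := polarDir_single_pair I hI hS hd₁ hd₂ (1, 0) haJ
    simp only [zero_mul, zero_add, one_mul] at h
    exact h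
  set va : Fin n → ZMod 2 := Pi.single (I.vars a 2) 1 with hva
  set wa : Fin n → ZMod 2 := Pi.single (I.vars a 3) 1 with hwa
  have hvau : va u = 0 := by rw [hva, Pi.single_eq_of_ne (Ne.symm ha2)]
  have hwau : wa u = 0 := by rw [hwa, Pi.single_eq_of_ne (Ne.symm ha3)]
  have h0u : (0 : Fin n → ZMod 2) u = κ₀ + 1 := by rw [Pi.zero_apply, hκ]; decide
  have hvaH : va u = κ₀ + 1 := by rw [hvau, hκ]; decide
  have hwaH : wa u = κ₀ + 1 := by rw [hwau, hκ]; decide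
  have hvwH : (va + wa) u = κ₀ + 1 := by rw [Pi.add_apply, hvau, hwau, add_zero, hκ]; decide
  have hquad := qDir_add I B (1, 0) va wa
  rcases hq6 with hc | hc
  · -- `q ≡ σ₀ + 1` on `H₁`: polar zero at the pair of `a`, but `q(x) = σ₀ + 1` forces `[a ∈ T₂] = 1`
    have hB0 : polarDir I B (1, 0) va wa = 0 := by
      rw [hc _ hvwH, hc _ hvaH, hc _ hwaH, hc _ h0u] at hquad
      have e2 : ∀ k s : ZMod 2, 1 + k = 1 + k + (1 + k) + (1 + k) + s → s = 0 := by decide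
      exact e2 _ _ hquad
    rw [hT₂] at hB0
    rw [hc x hxH, hB0, zero_add] at hq2
    have e2 : ∀ k : ZMod 2, 1 + k ≠ k := by decide
    exact e2 _ hq2
  · -- `q = u_e + σ₀ + 1` on `H₁`: polar of `Q_{D e}` at the pair of `a` is `1`, but `q(x) = σ₀` forces `[a ∈ T₂] = 0`
    have hB1 : polarDir I B (1, 0) va wa = 1 := by
      rw [hc _ hvwH, hc _ hvaH, hc _ hwaH, hc _ h0u, u_add I B e va wa] at hquad
      have hab : polar (B.D e) (fun j => I.vars j 2) (fun j => I.vars j 3) va wa = 1 := by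
        rw [hva, hwa, polar_basis I hI hS, if_pos ((andAdj_iff_mem I hI hS (B.D e) a).2 haD)]
      rw [hab] at hquad
      generalize (sys I B).u e va = p at hquad; generalize (sys I B).u e wa = q at hquad; generalize (sys I B).u e 0 = r at hquad
      generalize polarDir I B (1, 0) va wa = s at hquad
      have e5 : ∀ p q r s k : ZMod 2, p + q + r + 1 + k + 1 = p + k + 1 + (q + k + 1) + (r + k + 1) + s → s = 1 := by decide
      exact e5 _ _ _ _ _ hquad
    rw [hT₂] at hB1
    rw [hc x hxH, hue, hB1] at hq2
    have e2 : ∀ k : ZMod 2, 1 + k + 1 ≠ 1 + k := by decide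
    exact e2 _ hq2

end Summit.PneNP.PneNP.Theorems.PstarGateCaseTSixAffine
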